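import Summits.QuantumFields.BalabanUV.T4Continuum.Support.ShellMeasureLandauWilsonSquaresTwisted
import Summits.QuantumFields.BalabanUV.T4Continuum.Support.ShellMeasureLandauWilsonSquaresSchwarz

/-!
# `T4Continuum.ShellMeasureLandauWilsonSquaresTwistedSchwarz` — row S83 f2: the INTERLEAVED Wilson profile (γ5) with the
# SECOND-ORDER window constant (γ6) — S83's twisted read-outs through leaf-09's two-radii (Schwarz) chart-ray ENDs
(cell `pub-balaban`, sub-cell `t4`, spine estimate NE7c (node U5b); NE7c ROUND-2 crew, unit `b2b-balaban-t4-ne7c-formalise-leaf-08`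
gen 14; owner table `t4/b2b-balaban-t4-ne7c-p1/LEAVES-NE7c-P1.md` row S83 f2 (owner g32 «S83 f2 twisted ∘ Schwarz: GO AFTER leaf-09-g12's
S85 f2 lands, one call» R-ne7cp1-g32-3 (b) l.18202; S85 f2 LANDED p228495); ADDITIVE — imports my S83 `ShellMeasureLandauWilsonSquaresTwisted`
(p228145) + leaf-09-g12's S85 f2 `ShellMeasureLandauWilsonSquaresSchwarz` (p228495) ONLY; [folklore]; 0 `def`, 0 `def … : Prop`, 0 sorry,
0 citation tags; v1.1 APPEND-ONLY: + §2 rule G-1 joint-inhabitation `example` of the interleaved-data binders, `P_w ≠ ∅`)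

HONEST FRAMING.  Finite four-torus programme, rung (B)+1 only — NOT infinite volume, NOT a mass gap, NOT the Clay problem,
NOT summit progress; (B), `BetaPertHyp`, (B^μ) not consumed.  NE7c (`T4IndicatorShell.ShellWeightBound`) is NOT PRINTED in
[Balaban 1983–89] and NOT PROVED; «NE7c ⇐ the named binders» (trigger c3).  Nothing printed is asserted; no estimate of Bałaban's
is discharged; WIRING on OUR side: ONE call of leaf-09's `hE_landau_wilsonSquares_schwarz` ∕ `…_pinned_schwarz` on the twisted
read-outs and the background plaquette, then S83 `trace_interleaved_eq` pointwise — exactly S83 §3's script with the budget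
binder in S85's second-order shape and the located number `2S ≤ r_Φ` for `S < r_Φ` (owner (d) l.17926: «the twisted letters
have the SAME disc bounds, so the file composes with the Schwarz junction verbatim»; my XREAD C-ne7cleaf08-42 INFO-2∕3).  HONEST
DEPENDENCY (cell): continuum YM on T⁴ ⇐ BetaPertH ∧ nine spine estimates (0/9 proved); BetaPertH ⇐ (D1) ∧ (D4) ∧ CAP+tail;
G-an2-4 gates asym, D1 and NE2/3/4.

WHAT IS PROVED ([folklore]).  **`hE_landau_wilsonSquares_twisted_schwarz`** (flat) and **`hE_landau_wilsonSquares_pinned_twisted_schwarz`**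
(pinned, the live-level form): END-II's `hE` for the INTERLEAVED Wilson ray profile
`𝓔_W y := Σ_{p∈P_w} β·(1 − Re tr((Π_k u_{p,k}·exp(ℓ_{p,k}(Z y)))·u_{T,p})∕N)` with the SECOND-ORDER constant `3H̄⁽²⁾`,
`H̄⁽²⁾ ≥ Σ_p |β|(d_p + 2H_p∕(r_Φ∕S))(2H_p∕(r_Φ∕S))` — binders = S83 §3's VERBATIM except `hSr : S < r_Φ` ↦ `h2S : 2S ≤ r_Φ` and
`hsum` in the second-order shape (S85 f2's VERBATIM); `hcurl`∕`hcurlπ` on the TWISTED list (covariant curl); frozen factors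
unitary, background plaquette deviation `d_p` displayed.  NOTHING in the countdown moves; NE7c NOT PROVED; spine PROVED 0∕9.
-/

noncomputable section

open Set Metric NormedSpace
open scoped Matrix

namespace Summit.QuantumFields.BalabanUV.T4Continuum.ShellMeasureLandauWilsonSquaresTwistedSchwarz

open Literature.MathematicalPhysics.QuantumFieldTheory.Balaban1983to89
open B11Prop6Scheme (Prop4Hyp)
open T4ShellMeasurePlaquette (expTail₂)
open Summit.QuantumFields.BalabanUV.T4Continuum.ShellMeasureLandauHolonomy (solAt landauExp)
open Summit.QuantumFields.BalabanUV.T4Continuum.ShellMeasureLandauHolonomyChart (holOf holOf_apply cplx)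
open Summit.QuantumFields.BalabanUV.T4Continuum.ShellMeasureLandauWilsonSquaresTwisted (twistRO twistRO_length
  norm_twistRO_le twistRO_skew trace_interleaved_eq)
open Summit.QuantumFields.BalabanUV.T4Continuum.ShellMeasureLandauWilsonSquaresSchwarz (hE_landau_wilsonSquares_schwarz
  hE_landau_wilsonSquares_pinned_schwarz)

section ChartRay

open scoped Matrix.Norms.L2Operator

variable {nM : Type*} [Fintype nM] [DecidableEq nM] [Nonempty nM]
variable {𝒴 𝒴' 𝒳 𝒵 ℬ : Type*} [NormedAddCommGroup 𝒴] [NormedSpace ℂ 𝒴] [CompleteSpace 𝒴]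
  [NormedAddCommGroup 𝒴'] [NormedSpace ℂ 𝒴'] [NormedAddCommGroup 𝒳] [NormedSpace ℂ 𝒳] [CompleteSpace 𝒳]
  [NormedAddCommGroup 𝒵] [NormedSpace ℂ 𝒵] [NormedAddCommGroup ℬ] [NormedSpace ℂ ℬ]
variable {n : ℕ} {𝒢 : 𝒵 →L[ℂ] 𝒴} {W𝒱 : 𝒴 → 𝒵} {B₀ C₄ a₃ : ℝ}

/-- **END-II's `hE` FOR THE INTERLEAVED WILSON PROFILE — TWO RADII (flat).**  S83 `hE_landau_wilsonSquares_twisted` with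
`hSr : S < r_Φ` ↦ `h2S : 2S ≤ r_Φ` and the budget in S85's second-order shape; conclusion constant `3H̄` (no `∕(r_Φ∕S − 1)`).
ONE call of leaf-09's `hE_landau_wilsonSquares_schwarz` on `Bp := (Π_k u_{p,k})·uT p`, `ℓw := twistRO 1 (pairs p)`, then S83
`trace_interleaved_eq` pointwise. [folklore] -/
theorem hE_landau_wilsonSquares_twisted_schwarz {𝔭 : Type*} {W : Set (Fin n → ℝ)} {Pw : Finset 𝔭} {S : ℝ}
    (hS : 0 < S) (hWS : W ⊆ closedBall (0 : Fin n → ℝ) S)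
    (h𝒢 : ∀ f, ‖𝒢 f‖ ≤ B₀ * ‖f‖) (hW : Prop4Hyp W𝒱 C₄ a₃) (hB₀ : 0 < B₀) (hC₄ : 0 ≤ C₄)
    {b ε₄ : ℝ} (hε₄ : 0 ≤ ε₄) (hdom : 2 * (ε₄ + B₀ * b) ≤ a₃)
    (hself : B₀ * C₄ * (ε₄ + B₀ * b) ^ 2 ≤ ε₄) (hcontr : 4 * B₀ * C₄ * (ε₄ + B₀ * b) < 1)
    (H₁ : ℬ →L[ℂ] 𝒴) (hH₁ : ∀ B, ‖H₁ B‖ ≤ B₀ * ‖B‖)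
    {Φ : (Fin n → ℂ) → ℬ} {rΦ : ℝ} (hΦd : DifferentiableOn ℂ Φ (ball 0 rΦ)) (hΦ0 : Φ 0 = 0)
    (hΦ : ∀ z ∈ ball (0 : Fin n → ℂ) rΦ, ‖Φ z‖ < b) (h2S : 2 * S ≤ rΦ)
    {C : 𝒴' → 𝒳} {C₂ R : ℝ} (hC₂ : 0 ≤ C₂) (hCq : ∀ Z : 𝒴', ‖Z‖ < R → ‖C Z‖ ≤ C₂ * ‖Z‖ ^ 2)
    (hCd : DifferentiableOn ℂ C (ball 0 R)) (ι : 𝒴 →L[ℂ] 𝒴') (hι : ∀ Y, ‖ι Y‖ ≤ ‖Y‖) (H : 𝒳 →L[ℂ] 𝒴)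
    (hH : ∀ X, ‖H X‖ ≤ B₀ * ‖X‖) (hq : 9 * C₂ * B₀ * (ε₄ + B₀ * b) < 1) (hRC : 3 * (ε₄ + B₀ * b) ≤ R)
    -- INTERLEAVED plaquette data: per plaquette the (frozen factor, read-out) pairs and a trailing frozen factor
    (pairs : 𝔭 → List (Matrix nM nM ℂ × (𝒴 →L[ℂ] Matrix nM nM ℂ))) (uT : 𝔭 → Matrix nM nM ℂ)
    (hu : ∀ p ∈ Pw, ∀ q ∈ pairs p, q.1 ∈ unitary (Matrix nM nM ℂ)) (huT : ∀ p ∈ Pw, uT p ∈ unitary (Matrix nM nM ℂ))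
    -- the background plaquette's deviation from `1` (DISPLAYED)
    {d : 𝔭 → ℝ} (hBd : ∀ p ∈ Pw, ‖((pairs p).map Prod.fst).prod * uT p - 1‖ ≤ d p)
    -- per-letter read-out norms (UNtwisted) AND the covariant-curl read-out norm (on the TWISTED list) — DISPLAYED; lengths
    {κw κc : 𝔭 → ℝ} (hκw : ∀ p ∈ Pw, 0 ≤ κw p) (hκc : ∀ p ∈ Pw, 0 ≤ κc p)
    (hℓw : ∀ p ∈ Pw, ∀ q ∈ pairs p, ∀ Y, ‖q.2 Y‖ ≤ κw p * ‖Y‖)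
    (hcurl : ∀ p ∈ Pw, ∀ Y, ‖((twistRO 1 (pairs p)).map fun ℓ => ℓ Y).sum‖ ≤ κc p * ‖Y‖)
    {mw : ℕ} (hlenw : ∀ p ∈ Pw, (pairs p).length ≤ mw)
    -- the real structure (chain (A)) with SKEW (untwisted) read-outs (chain (E))
    (𝓡𝒴 : AddSubgroup 𝒴) (h𝓡𝒴 : IsClosed (𝓡𝒴 : Set 𝒴)) (𝓡𝒵 : AddSubgroup 𝒵) (𝓡𝒴' : AddSubgroup 𝒴')
    (𝓡𝒳 : AddSubgroup 𝒳) (h𝓡𝒳 : IsClosed (𝓡𝒳 : Set 𝒳)) (𝓡ℬ : AddSubgroup ℬ)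
    (h𝒢r : ∀ f ∈ 𝓡𝒵, 𝒢 f ∈ 𝓡𝒴) (hWr : ∀ Y ∈ 𝓡𝒴, W𝒱 Y ∈ 𝓡𝒵) (hιr : ∀ Y ∈ 𝓡𝒴, ι Y ∈ 𝓡𝒴')
    (hHr : ∀ X ∈ 𝓡𝒳, H X ∈ 𝓡𝒴) (hCr : ∀ Z ∈ 𝓡𝒴', C Z ∈ 𝓡𝒳) (hH₁r : ∀ B ∈ 𝓡ℬ, H₁ B ∈ 𝓡𝒴)
    (hΦr : ∀ y : Fin n → ℝ, ‖y‖ ≤ S → Φ (cplx y) ∈ 𝓡ℬ)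
    (hskew : ∀ p ∈ Pw, ∀ q ∈ pairs p, ∀ Y ∈ 𝓡𝒴, q.2 Y ∈ skewAdjoint (Matrix nM nM ℂ))
    -- the budget, second order per plaquette (VERBATIM as in S74 §4)
    {β Hbar : ℝ}
    (hsum : ∑ p ∈ Pw, |β| * (d p + 2 * (κc p * ((ε₄ + B₀ * b) + B₀ * (4 * C₂ * (ε₄ + B₀ * b) ^ 2)) +
        expTail₂ (mw * (κw p * ((ε₄ + B₀ * b) + B₀ * (4 * C₂ * (ε₄ + B₀ * b) ^ 2))))) / (rΦ / S)) *
      (2 * (κc p * ((ε₄ + B₀ * b) + B₀ * (4 * C₂ * (ε₄ + B₀ * b) ^ 2)) +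
        expTail₂ (mw * (κw p * ((ε₄ + B₀ * b) + B₀ * (4 * C₂ * (ε₄ + B₀ * b) ^ 2))))) / (rΦ / S)) ≤ Hbar) :
    ∀ x ∈ W, ∀ c : ℝ, 1 / 2 ≤ c → c ≤ 1 →
      (fun y => ∑ p ∈ Pw, β * (1 - (Matrix.trace ((((pairs p).map fun q => q.1 * exp (q.2 (landauExp C ι H
        (4 * C₂ * (ε₄ + B₀ * b) ^ 2) (solAt 𝒢 0 W𝒱 ε₄ (0 : 𝒵) (H₁ (Φ (cplx y))) + H₁ (Φ (cplx y)))))).prod) *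
          uT p)).re / Fintype.card nM)) (c • x) ≤
      (fun y => ∑ p ∈ Pw, β * (1 - (Matrix.trace ((((pairs p).map fun q => q.1 * exp (q.2 (landauExp C ι H
        (4 * C₂ * (ε₄ + B₀ * b) ^ 2) (solAt 𝒢 0 W𝒱 ε₄ (0 : 𝒵) (H₁ (Φ (cplx y))) + H₁ (Φ (cplx y)))))).prod) *
          uT p)).re / Fintype.card nM)) x +
        (1 - c) * (3 * Hbar) := by
  -- S74 §4 on the twisted read-outs and the background plaquettes
  have h := hE_landau_wilsonSquares_schwarz hS hWS h𝒢 hW hB₀ hC₄ hε₄ hdom hself hcontr H₁ hH₁ hΦd hΦ0 hΦ h2S hC₂ hCq hCd ι hι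
    H hH hq hRC (fun p => twistRO 1 (pairs p)) (κw := κw) (κc := κc) hκw hκc
    (fun p hp => norm_twistRO_le (pairs p) (unitary _).one_mem (hu p hp) (hℓw p hp)) hcurl
    (mw := mw) (fun p hp => by rw [twistRO_length]; exact hlenw p hp)
    𝓡𝒴 h𝓡𝒴 𝓡𝒵 𝓡𝒴' 𝓡𝒳 h𝓡𝒳 𝓡ℬ h𝒢r hWr hιr hHr hCr hH₁r hΦr
    (fun p hp => twistRO_skew 𝓡𝒴 (pairs p) 1 (hskew p hp))
    (fun p => ((pairs p).map Prod.fst).prod * uT p)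
    (fun p hp => (unitary _).mul_mem (list_prod_mem fun u hu' => by
      obtain ⟨q, hq', rfl⟩ := List.mem_map.1 hu'; exact hu p hp q hq') (huT p hp)) hBd hsum
  -- the two profiles agree pointwise: the interleaved trace IS the prefactor-times-twisted-word trace
  have key : (fun y => ∑ p ∈ Pw, β * (1 - (Matrix.trace ((((pairs p).map fun q => q.1 * exp (q.2 (landauExp C ι H
        (4 * C₂ * (ε₄ + B₀ * b) ^ 2) (solAt 𝒢 0 W𝒱 ε₄ (0 : 𝒵) (H₁ (Φ (cplx y))) + H₁ (Φ (cplx y)))))).prod) *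
          uT p)).re / Fintype.card nM)) =
      (fun y => ∑ p ∈ Pw, β * (1 - (Matrix.trace ((((pairs p).map Prod.fst).prod * uT p) * holOf (twistRO 1 (pairs p))
        (fun y => landauExp C ι H (4 * C₂ * (ε₄ + B₀ * b) ^ 2)
          (solAt 𝒢 0 W𝒱 ε₄ (0 : 𝒵) (H₁ (Φ (cplx y))) + H₁ (Φ (cplx y)))) y)).re / Fintype.card nM)) := by
    funext y
    refine Finset.sum_congr rfl fun p hp => ?_
    rw [holOf_apply, trace_interleaved_eq (pairs p) (hu p hp) (uT p)]
  rw [key]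
  exact h

variable {P𝒴 P𝒴' P𝒳 Pℬ : Type*} [NormedAddCommGroup P𝒴] [NormedSpace ℂ P𝒴] [NormedAddCommGroup P𝒴']
  [NormedSpace ℂ P𝒴'] [NormedAddCommGroup P𝒳] [NormedSpace ℂ P𝒳] [NormedAddCommGroup Pℬ] [NormedSpace ℂ Pℬ]

/-- **THE PINNED TWIN — TWO RADII** (the live-level form): S83 `hE_landau_wilsonSquares_pinned_twisted` with `h2S : 2S ≤ r_Φ`
and S85 f2 §3's second-order budget in `z_pin`; ONE call of leaf-09's `hE_landau_wilsonSquares_pinned_schwarz`. [folklore] -/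
theorem hE_landau_wilsonSquares_pinned_twisted_schwarz {𝔭 : Type*} {W : Set (Fin n → ℝ)} {Pw : Finset 𝔭} {S : ℝ}
    (hS : 0 < S) (hWS : W ⊆ closedBall (0 : Fin n → ℝ) S)
    (h𝒢 : ∀ f, ‖𝒢 f‖ ≤ B₀ * ‖f‖) (hW : Prop4Hyp W𝒱 C₄ a₃) (hB₀ : 0 < B₀) (hC₄ : 0 ≤ C₄)
    {b ε₄ : ℝ} (hε₄ : 0 ≤ ε₄) (hdom : 2 * (ε₄ + B₀ * b) ≤ a₃)
    (hself : B₀ * C₄ * (ε₄ + B₀ * b) ^ 2 ≤ ε₄) (hcontr : 4 * B₀ * C₄ * (ε₄ + B₀ * b) < 1)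
    (H₁ : ℬ →L[ℂ] 𝒴) (hH₁ : ∀ B, ‖H₁ B‖ ≤ B₀ * ‖B‖)
    {Φ : (Fin n → ℂ) → ℬ} {rΦ : ℝ} (hΦd : DifferentiableOn ℂ Φ (ball 0 rΦ)) (hΦ0 : Φ 0 = 0)
    (hΦ : ∀ z ∈ ball (0 : Fin n → ℂ) rΦ, ‖Φ z‖ < b) (h2S : 2 * S ≤ rΦ)
    {C : 𝒴' → 𝒳} {C₂ R : ℝ} (hC₂ : 0 ≤ C₂) (hCq : ∀ Z : 𝒴', ‖Z‖ < R → ‖C Z‖ ≤ C₂ * ‖Z‖ ^ 2)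
    (hCd : DifferentiableOn ℂ C (ball 0 R)) (ι : 𝒴 →L[ℂ] 𝒴') (hι : ∀ Y, ‖ι Y‖ ≤ ‖Y‖) (H : 𝒳 →L[ℂ] 𝒴)
    (hH : ∀ X, ‖H X‖ ≤ B₀ * ‖X‖) (hq : 9 * C₂ * B₀ * (ε₄ + B₀ * b) < 1) (hRC : 3 * (ε₄ + B₀ * b) ≤ R)
    -- the reading and leaf-07's pinned chain binders (DISPLAYED) — VERBATIM as in S74 f2 §3
    (π𝒴 : 𝒴 →L[ℂ] P𝒴) (π𝒴' : 𝒴' →L[ℂ] P𝒴') (π𝒳 : 𝒳 →L[ℂ] P𝒳) (πℬ : ℬ →L[ℂ] Pℬ) {qW LC cι BH B₁p bp : ℝ}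
    (hGWp : ∀ Y Y', ‖Y‖ < ε₄ + B₀ * b → ‖Y'‖ < ε₄ + B₀ * b →
      ‖π𝒴 (𝒢 (W𝒱 Y)) - π𝒴 (𝒢 (W𝒱 Y'))‖ ≤ qW * ‖π𝒴 Y - π𝒴 Y'‖) (hqW : qW < 1)
    (hCp : ∀ A A' : 𝒴', ‖A‖ < R → ‖A'‖ < R → ‖π𝒳 (C A) - π𝒳 (C A')‖ ≤ LC * ‖π𝒴' A - π𝒴' A'‖)
    (hιp : ∀ Y, ‖π𝒴' (ι Y)‖ ≤ cι * ‖π𝒴 Y‖) (hHp : ∀ X, ‖π𝒴 (H X)‖ ≤ BH * ‖π𝒳 X‖)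
    (hLC : 0 ≤ LC) (hcι : 0 ≤ cι) (hBH : 0 ≤ BH) (hk : LC * cι * BH < 1)
    (hB₁p : 0 ≤ B₁p) (hH₁p : ∀ B, ‖π𝒴 (H₁ B)‖ ≤ B₁p * ‖πℬ B‖)
    (hΦp : ∀ z ∈ ball (0 : Fin n → ℂ) rΦ, ‖πℬ (Φ z)‖ ≤ bp) (hbp : 0 ≤ bp)
    -- INTERLEAVED plaquette data
    (pairs : 𝔭 → List (Matrix nM nM ℂ × (𝒴 →L[ℂ] Matrix nM nM ℂ))) (uT : 𝔭 → Matrix nM nM ℂ)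
    (hu : ∀ p ∈ Pw, ∀ q ∈ pairs p, q.1 ∈ unitary (Matrix nM nM ℂ)) (huT : ∀ p ∈ Pw, uT p ∈ unitary (Matrix nM nM ℂ))
    {d : 𝔭 → ℝ} (hBd : ∀ p ∈ Pw, ‖((pairs p).map Prod.fst).prod * uT p - 1‖ ≤ d p)
    -- PINNED per-letter read-out norms (UNtwisted) AND the pinned covariant-curl read-out norm (TWISTED list); lengths
    {κw κc : 𝔭 → ℝ} (hκw : ∀ p ∈ Pw, 0 ≤ κw p) (hκc : ∀ p ∈ Pw, 0 ≤ κc p)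
    (hℓwπ : ∀ p ∈ Pw, ∀ q ∈ pairs p, ∀ Y, ‖q.2 Y‖ ≤ κw p * ‖π𝒴 Y‖)
    (hcurlπ : ∀ p ∈ Pw, ∀ Y, ‖((twistRO 1 (pairs p)).map fun ℓ => ℓ Y).sum‖ ≤ κc p * ‖π𝒴 Y‖)
    {mw : ℕ} (hlenw : ∀ p ∈ Pw, (pairs p).length ≤ mw)
    -- the real structure with SKEW (untwisted) read-outs
    (𝓡𝒴 : AddSubgroup 𝒴) (h𝓡𝒴 : IsClosed (𝓡𝒴 : Set 𝒴)) (𝓡𝒵 : AddSubgroup 𝒵) (𝓡𝒴' : AddSubgroup 𝒴')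
    (𝓡𝒳 : AddSubgroup 𝒳) (h𝓡𝒳 : IsClosed (𝓡𝒳 : Set 𝒳)) (𝓡ℬ : AddSubgroup ℬ)
    (h𝒢r : ∀ f ∈ 𝓡𝒵, 𝒢 f ∈ 𝓡𝒴) (hWr : ∀ Y ∈ 𝓡𝒴, W𝒱 Y ∈ 𝓡𝒵) (hιr : ∀ Y ∈ 𝓡𝒴, ι Y ∈ 𝓡𝒴')
    (hHr : ∀ X ∈ 𝓡𝒳, H X ∈ 𝓡𝒴) (hCr : ∀ Z ∈ 𝓡𝒴', C Z ∈ 𝓡𝒳) (hH₁r : ∀ B ∈ 𝓡ℬ, H₁ B ∈ 𝓡𝒴)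
    (hΦr : ∀ y : Fin n → ℝ, ‖y‖ ≤ S → Φ (cplx y) ∈ 𝓡ℬ)
    (hskew : ∀ p ∈ Pw, ∀ q ∈ pairs p, ∀ Y ∈ 𝓡𝒴, q.2 Y ∈ skewAdjoint (Matrix nM nM ℂ))
    -- the budget in `z_pin` (VERBATIM as in S74 f2 §3)
    {β Hbar : ℝ}
    (hsum : ∑ p ∈ Pw, |β| * (d p + 2 * (κc p * (B₁p * bp / ((1 - qW) * (1 - LC * cι * BH))) +
        expTail₂ (mw * (κw p * (B₁p * bp / ((1 - qW) * (1 - LC * cι * BH)))))) / (rΦ / S)) *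
      (2 * (κc p * (B₁p * bp / ((1 - qW) * (1 - LC * cι * BH))) +
        expTail₂ (mw * (κw p * (B₁p * bp / ((1 - qW) * (1 - LC * cι * BH)))))) / (rΦ / S)) ≤ Hbar) :
    ∀ x ∈ W, ∀ c : ℝ, 1 / 2 ≤ c → c ≤ 1 →
      (fun y => ∑ p ∈ Pw, β * (1 - (Matrix.trace ((((pairs p).map fun q => q.1 * exp (q.2 (landauExp C ι H
        (4 * C₂ * (ε₄ + B₀ * b) ^ 2) (solAt 𝒢 0 W𝒱 ε₄ (0 : 𝒵) (H₁ (Φ (cplx y))) + H₁ (Φ (cplx y)))))).prod) *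
          uT p)).re / Fintype.card nM)) (c • x) ≤
      (fun y => ∑ p ∈ Pw, β * (1 - (Matrix.trace ((((pairs p).map fun q => q.1 * exp (q.2 (landauExp C ι H
        (4 * C₂ * (ε₄ + B₀ * b) ^ 2) (solAt 𝒢 0 W𝒱 ε₄ (0 : 𝒵) (H₁ (Φ (cplx y))) + H₁ (Φ (cplx y)))))).prod) *
          uT p)).re / Fintype.card nM)) x +
        (1 - c) * (3 * Hbar) := by
  -- S74 f2 §3 on the twisted read-outs and the background plaquettes
  have h := hE_landau_wilsonSquares_pinned_schwarz hS hWS h𝒢 hW hB₀ hC₄ hε₄ hdom hself hcontr H₁ hH₁ hΦd hΦ0 hΦ h2S hC₂ hCq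
    hCd ι hι H hH hq hRC π𝒴 π𝒴' π𝒳 πℬ hGWp hqW hCp hιp hHp hLC hcι hBH hk hB₁p hH₁p hΦp hbp
    (fun p => twistRO 1 (pairs p)) (κw := κw) (κc := κc) hκw hκc
    (fun p hp => norm_twistRO_le (pairs p) (unitary _).one_mem (hu p hp) (hℓwπ p hp)) hcurlπ
    (mw := mw) (fun p hp => by rw [twistRO_length]; exact hlenw p hp)
    𝓡𝒴 h𝓡𝒴 𝓡𝒵 𝓡𝒴' 𝓡𝒳 h𝓡𝒳 𝓡ℬ h𝒢r hWr hιr hHr hCr hH₁r hΦr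
    (fun p hp => twistRO_skew 𝓡𝒴 (pairs p) 1 (hskew p hp))
    (fun p => ((pairs p).map Prod.fst).prod * uT p)
    (fun p hp => (unitary _).mul_mem (list_prod_mem fun u hu' => by
      obtain ⟨q, hq', rfl⟩ := List.mem_map.1 hu'; exact hu p hp q hq') (huT p hp)) hBd hsum
  have key : (fun y => ∑ p ∈ Pw, β * (1 - (Matrix.trace ((((pairs p).map fun q => q.1 * exp (q.2 (landauExp C ι H
        (4 * C₂ * (ε₄ + B₀ * b) ^ 2) (solAt 𝒢 0 W𝒱 ε₄ (0 : 𝒵) (H₁ (Φ (cplx y))) + H₁ (Φ (cplx y)))))).prod) *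
          uT p)).re / Fintype.card nM)) =
      (fun y => ∑ p ∈ Pw, β * (1 - (Matrix.trace ((((pairs p).map Prod.fst).prod * uT p) * holOf (twistRO 1 (pairs p))
        (fun y => landauExp C ι H (4 * C₂ * (ε₄ + B₀ * b) ^ 2)
          (solAt 𝒢 0 W𝒱 ε₄ (0 : 𝒵) (H₁ (Φ (cplx y))) + H₁ (Φ (cplx y)))) y)).re / Fintype.card nM)) := by
    funext y
    refine Finset.sum_congr rfl fun p hp => ?_
    rw [holOf_apply, trace_interleaved_eq (pairs p) (hu p hp) (uT p)]
  rw [key]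
  exact h

end ChartRay

/-! ## §2 (v1.1, APPEND-ONLY) Rule G-1: the INTERLEAVED-DATA binder family is jointly inhabited on a nonempty index set
The binders this file (and S83 §3) ADD to S74's END — `hu`, `huT`, `hBd`, `hκw`, `hκc`, `hℓw`, `hcurl` (on the TWISTED list),
`hlenw`, `hskew` — are met SIMULTANEOUSLY by explicit data with `P_w = {⋆}` nonempty and a nonempty pair list: one position with
frozen factor `1` and the zero read-out, trailing factor `1`, `d = κ_w = κ_c = 0`, `m_w = 1` (crew rule G-1, owner table v3.7;
the chain ∕ pinned-chain families are S74's ∕ S76's and are exhibited by row S88).  No mathematics; a vacuity guard. -/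

section NonVacuity

open scoped Matrix.Norms.L2Operator

/-- **G-1 JOINT INHABITATION of the interleaved-data binders** (`𝒴 := ℂ`, `M_1(ℂ)`, `P_w = {()} ≠ ∅`,
`pairs () = [(1, 0)]`, `uT () = 1`). [folklore] -/
example :
    let Pw : Finset Unit := {()}
    let pairs : Unit → List (Matrix (Fin 1) (Fin 1) ℂ × (ℂ →L[ℂ] Matrix (Fin 1) (Fin 1) ℂ)) := fun _ => [(1, 0)]
    let uT : Unit → Matrix (Fin 1) (Fin 1) ℂ := fun _ => 1
    let d : Unit → ℝ := fun _ => 0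
    let κw : Unit → ℝ := fun _ => 0
    let κc : Unit → ℝ := fun _ => 0
    Pw.Nonempty ∧
    (∀ p ∈ Pw, ∀ q ∈ pairs p, q.1 ∈ unitary (Matrix (Fin 1) (Fin 1) ℂ)) ∧
    (∀ p ∈ Pw, uT p ∈ unitary (Matrix (Fin 1) (Fin 1) ℂ)) ∧
    (∀ p ∈ Pw, ‖((pairs p).map Prod.fst).prod * uT p - 1‖ ≤ d p) ∧
    (∀ p ∈ Pw, 0 ≤ κw p) ∧ (∀ p ∈ Pw, 0 ≤ κc p) ∧
    (∀ p ∈ Pw, ∀ q ∈ pairs p, ∀ Y : ℂ, ‖q.2 Y‖ ≤ κw p * ‖Y‖) ∧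
    (∀ p ∈ Pw, ∀ Y : ℂ, ‖((twistRO 1 (pairs p)).map fun ℓ => ℓ Y).sum‖ ≤ κc p * ‖Y‖) ∧
    (∀ p ∈ Pw, (pairs p).length ≤ 1) ∧
    (∀ p ∈ Pw, ∀ q ∈ pairs p, ∀ Y ∈ (⊤ : AddSubgroup ℂ), q.2 Y ∈ skewAdjoint (Matrix (Fin 1) (Fin 1) ℂ)) := by
  refine ⟨Finset.singleton_nonempty _, ?_, ?_, ?_, ?_, ?_, ?_, ?_, ?_, ?_⟩
  · intro p _ q hq
    simp only [List.mem_singleton] at hq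
    subst hq
    exact (unitary _).one_mem
  · intro p _; exact (unitary _).one_mem
  · intro p _; simp
  · intro p _; simp
  · intro p _; simp
  · intro p _ q hq Y
    simp only [List.mem_singleton] at hq
    subst hq
    simp
  · intro p _ Y
    simp
  · intro p _; simp
  · intro p _ q hq Y _
    simp only [List.mem_singleton] at hq
    subst hq
    simp

end NonVacuity

end Summit.QuantumFields.BalabanUV.T4Continuum.ShellMeasureLandauWilsonSquaresTwistedSchwarz

end
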